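import Mathlib
import HarnessLib
import Summits.HubbardSuperconductivity.HubbardSuperconductivity.Theorems.KLProgrammePerturbedFermiCurveTwoFrameBand34
import Summits.HubbardSuperconductivity.HubbardSuperconductivity.Theorems.KLProgrammePerturbedFermiCurveHigherDerivsFrame

/-!
# Route `KLProgramme` — the frame's Fermi-radius tower on a LEVEL WINDOW, keyed to SHARP free-band numbers:
# `|u_K^{(k)}(θ)| ≤ R_k(window) + W_k(A₀, A₁, A₂)` (orders 0, 1, 2), with the free-band constants as named inputs

Cell `gate-hubbard-kl`, seat hubbard-kl-k3c3-p3 (g7; row «implicit-function / monotonicity route for μ(n)»); helper for the engine-flow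
child `KLRegimeEngineV17F2` (stmt-HubbardSuperconductivity-20437), stub (C) `stub_twoLeg_curvature`, plan (R47r) (KL STATUS l.3231):
«the landed generic `klJacG` table overshoots the natural chart-Jacobian jets by 10²–10³ at orders 1–2 ⇒ replace by a window-specific
certified bundle».  The overshoot is the lineage's UNIFORM slope bound `|u_K′| ≤ (4+2A)π√2/(Dt_min − 2A)` (`abs_deriv_frameRadius_le_uniform`,
≈ 27 on `klWindowC ± 3/80` against the natural `sup|u′| = 1.47`).  This module replaces it by the two-frame route at `K′ = K`, `K = 0`:
the frame's radius `u_K = perturbedFermiRadius δ_K ν` differs from the FREE radius `u = bandFermiRadius ν` by amounts LINEAR in the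
per-order sizes of the frame, so every SHARP bound on the free band's polar tower on a level window transfers to the frame with an
explicit `O(frame)` width:

* inputs (free band, level window `[a, b]`, hypotheses `hU₀ hR₁ hR₂`): `bandFermiRadius μ θ ≤ U₀`, `|∂_θ bandFermiRadius μ θ| ≤ R₁`,
  `|∂_θ² bandFermiRadius μ θ| ≤ R₂` for all `μ ∈ [a, b]`, all `θ` — the numbers of the certified table (kit j284117/j284240, two interval
  engines; e.g. on `[-1.1, -0.1]`: `U₀ = 2.825`, `R₁ = 1.5742`, `R₂ = 22.836`, `Dt_min = 0.6226`), entering as HYPOTHESES (KLCert pattern) or,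
  for `Dt_min`/`U₀`, from fs-1's closed forms (`…FermiSurfaceSharpTransversal`, `…SharpRange`); `B : BandBounds a b` supplies `Dt_min`;
* inputs (frame `K : TrigPolyC4v`, PER-ORDER sizes): `‖D⁰ frameShift K‖ ≤ A₀`, `‖D¹ frameShift K‖ ≤ A₁`, `‖D² frameShift K‖ ≤ A₂` on `Momentum`
  (from `FrameOK` by `norm_iteratedFDeriv_frameShift_le_sum_of_frameOK`: `A₀ = O(U)`, `A₁ = O(U²)`, `A₂ = O(Gfr₂·U²·#pieces)`), `2A₁ < Dt_min`,
  level `ν` with `[ν − A₀, ν + A₀] ⊂ [a, b]`;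
* outputs at every angle `θ` (§2): `|u_K − u| ≤ W₀ := A₀/(Dt_min − 2A₁)`; `|u_K′ − u′| ≤ W₁` and `|u_K′| ≤ R₁ + W₁`;
  `|u_K″ − u″| ≤ W₂` and `|u_K″| ≤ R₂ + W₂`, with `W₁, W₂` in closed form, affine in `(A₀, A₁, A₂)` up to the harmless products, and
  built from the SHARP `R₁, R₂` (not from the uniform bound); the radial transversality `Dt_min − 2A₁ ≤ ∂_t(ε₀ + δ_K)(u_K·dir θ)[dir θ]` and
  the range `u_K ≤ U₀ + W₀` (§1/§2) — i.e. the `ρ₀, U₀, R₁, R₂` inputs of c4a-1's `…C4aJacobianPolarJets` on the window.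

The literal `4 + 0`, `2 * 0` in the closed forms are the two-frame lemmas' `4 + κ_j`, `2κ₄` at the free side's `κ_j = 0` (kept verbatim so
that the proofs are the lemmas themselves).  Everything is PROVED; no definitions; nothing about the Hubbard model beyond the free band `ε₀`.  References: BGM 2006 §2.4 Lemma 2.1
(2.40) [cite: BenfattoGiulianiMastropietro2006]; certified table HOME/hubbard-kl-k3c3-p3/WINDOW-JETS.md.
-/

noncomputable section

namespace Summit.HubbardSuperconductivity.HubbardSuperconductivity.Theorems.PerturbedFermiCurve

set_option linter.dupNamespace false -- summit = problem name (single-conjunct summit), D-0017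
set_option maxSynthPendingDepth 4 -- nested operator-norm instances (up to fourth Fréchet derivatives)

open Real Set
open Literature.MathematicalPhysics.QuantumLattice Literature.MathematicalPhysics.QuantumLattice.BandSectorCounting
open Summit.HubbardSuperconductivity.HubbardSuperconductivity.Theorems.DispersionFlow
open Summit.HubbardSuperconductivity.HubbardSuperconductivity.Theorems.KLRegimeSplit

/-! ## §1 Per-order data of a frame on `Fin 2 → ℝ`, and the (trivial) data of the free band `δ = 0` -/

section Frame

variable {a b : ℝ} (B : BandBounds a b) {K : TrigPolyC4v} {A₀ A₁ A₂ : ℝ}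
  (hA₀ : ∀ p : Momentum, ‖iteratedFDeriv ℝ 0 (frameShift K) p‖ ≤ A₀)
  (hA₁ : ∀ p : Momentum, ‖iteratedFDeriv ℝ 1 (frameShift K) p‖ ≤ A₁)
  (hA₂ : ∀ p : Momentum, ‖iteratedFDeriv ℝ 2 (frameShift K) p‖ ≤ A₂) {A₃ A₄ : ℝ}
  (hA₃ : ∀ p : Momentum, ‖iteratedFDeriv ℝ 3 (frameShift K) p‖ ≤ A₃)
  (hA₄ : ∀ p : Momentum, ‖iteratedFDeriv ℝ 4 (frameShift K) p‖ ≤ A₄)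
  (hA₁Dt : 2 * A₁ < B.Dtmin) {ν : ℝ} (hlo : a ≤ ν - A₀) (hhi : ν + A₀ ≤ b)

omit B in
/-- `δ_K = -K` is `C⁴` on `Fin 2 → ℝ`. -/
theorem contDiff_four_negEval : ContDiff ℝ 4 (fun p : Fin 2 → ℝ => -K.eval p) := by
  rw [← frameShift_toLp_eq_neg_eval]; exact contDiff_frameShift_toLp K

include hA₀ in
omit B in
/-- Order 0, per-order transport: `|δ_K(k)| ≤ A₀`. -/
theorem abs_negEval_le (k : Fin 2 → ℝ) : |(fun p : Fin 2 → ℝ => -K.eval p) k| ≤ A₀ := by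
  have h := norm_iteratedFDeriv_frameShift_toLp_le_single hA₀ k
  rw [norm_iteratedFDeriv_zero, Real.norm_eq_abs, pow_zero, mul_one] at h
  simpa [frameShift_toLp] using h

include hA₁ in
omit B in
/-- Order 1, per-order transport: `‖Dδ_K(k)‖ ≤ 2A₁`. -/
theorem norm_fderiv_negEval_le (k : Fin 2 → ℝ) : ‖fderiv ℝ (fun p : Fin 2 → ℝ => -K.eval p) k‖ ≤ 2 * A₁ := by
  have h := norm_iteratedFDeriv_frameShift_toLp_le_single hA₁ k
  rw [norm_iteratedFDeriv_one, pow_one] at h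
  rw [← frameShift_toLp_eq_neg_eval]
  linarith

include hA₂ in
omit B in
/-- Order 2, per-order transport: `‖D²δ_K(k)‖ ≤ 4A₂`. -/
theorem norm_fderiv_two_negEval_le (k : Fin 2 → ℝ) :
    ‖fderiv ℝ (fderiv ℝ (fun p : Fin 2 → ℝ => -K.eval p)) k‖ ≤ 4 * A₂ := by
  have h := norm_iteratedFDeriv_frameShift_toLp_le_single hA₂ k
  rw [← frameShift_toLp_eq_neg_eval, norm_fderiv_two_eq_norm_iteratedFDeriv]
  linarith

include B hA₀ hlo hhi in
/-- The frame's canonical radius is a root selection of `ε₀ + δ_K` at level `ν` (margins `A₀`). -/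
theorem isBandFermiRadius_frameRadius_perOrder (θ : ℝ) :
    IsBandFermiRadius (ν - (fun p : Fin 2 → ℝ => -K.eval p) (perturbedFermiRadius (fun p : Fin 2 → ℝ => -K.eval p) ν θ • dir θ)) θ
      (perturbedFermiRadius (fun p : Fin 2 → ℝ => -K.eval p) ν θ) :=
  isBandFermiRadius_perturbedFermiRadius B (contDiff_four_negEval (K := K)).continuous (fun k _ => abs_negEval_le hA₀ k) hlo hhi θ

omit hA₁Dt in
include B hA₀ hlo hhi in
/-- The window's level is in the band: `-4 < ν < 0`. -/
theorem level_mem_band : -4 < ν ∧ ν < 0 := by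
  have hA : 0 ≤ A₀ := le_trans (norm_nonneg _) (hA₀ 0)
  exact ⟨by linarith [B.ha], by linarith [B.hb]⟩

include B hA₀ hlo hhi in
/-- The free radius at level `ν` is a root selection of `ε₀ + 0`. -/
theorem isBandFermiRadius_free (θ : ℝ) :
    IsBandFermiRadius (ν - (0 : (Fin 2 → ℝ) → ℝ) (bandFermiRadius ν θ • dir θ)) θ (bandFermiRadius ν θ) := by
  obtain ⟨h4, h0⟩ := level_mem_band B hA₀ hlo hhi
  simpa using isBandFermiRadius_bandFermiRadius h4 h0 θ

/-! ## §2 Free band versus frame: orders 0, 1, 2 at every angle, with SHARP free-band inputs -/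

include B hA₀ hA₁ hA₁Dt hlo hhi in
/-- **Order 0**: `|u_K(θ) − u(θ)| ≤ A₀/(Dt_min − 2A₁)`. [cite: BenfattoGiulianiMastropietro2006, §2.4 Lemma 2.1 (2.40)] -/
theorem abs_frameRadius_sub_bandFermiRadius_le (θ : ℝ) :
    |perturbedFermiRadius (fun p : Fin 2 → ℝ => -K.eval p) ν θ - bandFermiRadius ν θ| ≤ A₀ / (B.Dtmin - 2 * A₁) := by
  have hA0 : 0 ≤ A₀ := le_trans (norm_nonneg _) (hA₀ 0)
  have hA1 : 0 ≤ A₁ := le_trans (norm_nonneg _) (hA₁ 0)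
  have h := abs_root_sub_root_le B (δ := (0 : (Fin 2 → ℝ) → ℝ)) (δ' := fun p : Fin 2 → ℝ => -K.eval p) contDiff_const
    (κ₀ := A₀) (κ₁ := 2 * A₁) (fun k _ => by simpa using hA0) (fun k _ => abs_negEval_le hA₀ k) hlo hhi
    (fun k _ => by simp; positivity) hA₁Dt (u := bandFermiRadius ν) (v := perturbedFermiRadius (fun p : Fin 2 → ℝ => -K.eval p) ν)
    (isBandFermiRadius_free B hA₀ hlo hhi) (isBandFermiRadius_frameRadius_perOrder B hA₀ hlo hhi)
    (E₀ := A₀) (fun k _ => by simpa using abs_negEval_le hA₀ k) θ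
  exact h

include B hA₀ hA₁ hA₁Dt hlo hhi in
/-- **Range**: with `u(θ) ≤ U₀` on the window, `u_K(θ) ≤ U₀ + A₀/(Dt_min − 2A₁)`; and `u_K(θ) ≥ u_min − A₀/(Dt_min − 2A₁)`. -/
theorem frameRadius_le_of_window {U₀ : ℝ} (hU₀ : ∀ μ ∈ Icc a b, ∀ θ : ℝ, bandFermiRadius μ θ ≤ U₀) (θ : ℝ) :
    perturbedFermiRadius (fun p : Fin 2 → ℝ => -K.eval p) ν θ ≤ U₀ + A₀ / (B.Dtmin - 2 * A₁) ∧
    B.umin - A₀ / (B.Dtmin - 2 * A₁) ≤ perturbedFermiRadius (fun p : Fin 2 → ℝ => -K.eval p) ν θ := by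
  have hA0 : 0 ≤ A₀ := le_trans (norm_nonneg _) (hA₀ 0)
  have hν : ν ∈ Icc a b := ⟨by linarith, by linarith⟩
  have h := abs_frameRadius_sub_bandFermiRadius_le B hA₀ hA₁ hA₁Dt hlo hhi θ
  have h1 := hU₀ ν hν θ
  have h2 := B.umin_le ν hν θ
  constructor
  · linarith [(abs_le.1 h).2]
  · linarith [(abs_le.1 h).1]

include B hA₀ hA₁ hlo hhi in
/-- **Radial transversality at the frame's Fermi point**: `Dt_min − 2A₁ ≤ ∂_t(ε₀ + δ_K)(u_K(θ)·dir θ)[dir θ]` — the `ρ₀` of the window. -/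
theorem Dtmin_sub_le_fderiv_frameBand_dir (θ : ℝ) :
    B.Dtmin - 2 * A₁ ≤ fderiv ℝ (fun k : Fin 2 → ℝ => sqDispersion k + (fun p : Fin 2 → ℝ => -K.eval p) k)
      (perturbedFermiRadius (fun p : Fin 2 → ℝ => -K.eval p) ν θ • dir θ) (dir θ) :=
  Dtmin_sub_le_fderiv_pertBand_dir B (fun k _ => abs_negEval_le hA₀ k) hlo hhi (fun k _ => norm_fderiv_negEval_le hA₁ k)
    (isBandFermiRadius_frameRadius_perOrder B hA₀ hlo hhi) contDiff_four_negEval θ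

include B hA₀ hA₁ hA₁Dt hlo hhi in
/-- **Order 1, two radii**: with `W₀ = A₀/(Dt_min − 2A₁)`,
`|u_K′(θ) − u′(θ)| ≤ ((4+2A₁)W₀ + (π√2 + (4+2A₁)π√2/(Dt_min − 2A₁))·(4W₀ + 2A₁))/(Dt_min − 2A₁)` — `O(A₀ + A₁)`.
[cite: BenfattoGiulianiMastropietro2006, §2.4 Lemma 2.1 (2.40)] -/
theorem abs_deriv_frameRadius_sub_bandFermiRadius_le (θ : ℝ) :
    |deriv (perturbedFermiRadius (fun p : Fin 2 → ℝ => -K.eval p) ν) θ - deriv (bandFermiRadius ν) θ| ≤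
      ((4 + 2 * A₁) * (A₀ / (B.Dtmin - 2 * A₁)) +
        (π * Real.sqrt 2 + (4 + 2 * A₁) * (π * Real.sqrt 2) / (B.Dtmin - 2 * A₁)) * ((4 + 0) * (A₀ / (B.Dtmin - 2 * A₁)) + 2 * A₁)) /
        (B.Dtmin - 2 * A₁) := by
  have hA0 : 0 ≤ A₀ := le_trans (norm_nonneg _) (hA₀ 0)
  have hA1 : 0 ≤ A₁ := le_trans (norm_nonneg _) (hA₁ 0)
  have h := abs_deriv_root_sub_le B (δ := (0 : (Fin 2 → ℝ) → ℝ)) (δ' := fun p : Fin 2 → ℝ => -K.eval p) contDiff_const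
    contDiff_four_negEval (κ₀ := A₀) (κ₁ := 2 * A₁) (fun k _ => by simpa using hA0) (fun k _ => abs_negEval_le hA₀ k) hlo hhi
    (fun k _ => by simp; positivity) (fun k _ => norm_fderiv_negEval_le hA₁ k) hA₁Dt (u := bandFermiRadius ν)
    (v := perturbedFermiRadius (fun p : Fin 2 → ℝ => -K.eval p) ν)
    (isBandFermiRadius_free B hA₀ hlo hhi) (isBandFermiRadius_frameRadius_perOrder B hA₀ hlo hhi)
    (E₀ := A₀) (fun k _ => by simpa using abs_negEval_le hA₀ k) (κ₂ := 0) (E₁ := 2 * A₁) (fun k _ => by simp)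
    (fun k _ => by simpa using norm_fderiv_negEval_le hA₁ k) θ
  exact h

include B hA₀ hA₁ hA₂ hA₁Dt hlo hhi in
/-- **Order 2, two radii (incremental, SHARP inputs)**: with `R₁ ≥ |u′(θ)|` and `R₂ ≥ |u″(θ)|` for the FREE band at `θ` (the window's
certified numbers), `R₁′ ≥ |u_K′(θ)|` (e.g. `R₁ + W₁`) and `W₁ ≥ |u_K′(θ) − u′(θ)|`, `W₀ = A₀/(Dt_min − 2A₁)`, `Δ₁ = 4W₀ + 2A₁`,
`Δ₂ = 4W₀ + 4A₂`, `K₁ = R₁′ + π√2`: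
`|u_K″(θ) − u″(θ)| ≤ W₀ + (Δ₂K₁² + 2·4·K₁(W₁+W₀) + Δ₁(2R₁′+π√2) + (4+2A₁)(W₀+2W₁) + (R₂+π√2)Δ₁)/(Dt_min − 2A₁)` — `O(A₀ + A₁ + A₂)`.
[cite: BenfattoGiulianiMastropietro2006, §2.4 Lemma 2.1 (2.40)] -/
theorem abs_deriv_two_frameRadius_sub_bandFermiRadius_le {θ R₁' R₂ W₁ : ℝ} (hR₁ : |deriv (bandFermiRadius ν) θ| ≤ R₁')
    (hR₁' : |deriv (perturbedFermiRadius (fun p : Fin 2 → ℝ => -K.eval p) ν) θ| ≤ R₁')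
    (hR₂ : |deriv (deriv (bandFermiRadius ν)) θ| ≤ R₂)
    (hW₁ : |deriv (perturbedFermiRadius (fun p : Fin 2 → ℝ => -K.eval p) ν) θ - deriv (bandFermiRadius ν) θ| ≤ W₁) :
    |deriv (deriv (perturbedFermiRadius (fun p : Fin 2 → ℝ => -K.eval p) ν)) θ - deriv (deriv (bandFermiRadius ν)) θ| ≤
      A₀ / (B.Dtmin - 2 * A₁) +
        (((4 + 0) * (A₀ / (B.Dtmin - 2 * A₁)) + 4 * A₂) * (R₁' + π * Real.sqrt 2) ^ 2 +
          2 * (4 + 0) * (R₁' + π * Real.sqrt 2) * (W₁ + A₀ / (B.Dtmin - 2 * A₁)) +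
          ((4 + 0) * (A₀ / (B.Dtmin - 2 * A₁)) + 2 * A₁) * (2 * R₁' + π * Real.sqrt 2) +
          (4 + 2 * A₁) * (A₀ / (B.Dtmin - 2 * A₁) + 2 * W₁) +
          (R₂ + π * Real.sqrt 2) * ((4 + 0) * (A₀ / (B.Dtmin - 2 * A₁)) + 2 * A₁)) / (B.Dtmin - 2 * A₁) := by
  have hA0 : 0 ≤ A₀ := le_trans (norm_nonneg _) (hA₀ 0)
  have hA1 : 0 ≤ A₁ := le_trans (norm_nonneg _) (hA₁ 0)
  have h := abs_deriv_two_root_sub_le B (δ := (0 : (Fin 2 → ℝ) → ℝ)) (δ' := fun p : Fin 2 → ℝ => -K.eval p) contDiff_const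
    contDiff_four_negEval (κ₀ := A₀) (κ₁ := 2 * A₁) (fun k _ => by simpa using hA0) (fun k _ => abs_negEval_le hA₀ k) hlo hhi
    (fun k _ => by simp; positivity) (fun k _ => norm_fderiv_negEval_le hA₁ k) hA₁Dt (u := bandFermiRadius ν)
    (v := perturbedFermiRadius (fun p : Fin 2 → ℝ => -K.eval p) ν)
    (isBandFermiRadius_free B hA₀ hlo hhi) (isBandFermiRadius_frameRadius_perOrder B hA₀ hlo hhi)
    (E₀ := A₀) (fun k _ => by simpa using abs_negEval_le hA₀ k) (κ₂ := 0) (κ₃ := 0) (E₁ := 2 * A₁) (E₂ := 4 * A₂)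
    (fun k _ => by simp) (fun k _ => by simp) (fun k _ => by simpa using norm_fderiv_negEval_le hA₁ k)
    (fun k _ => by simpa using norm_fderiv_two_negEval_le hA₂ k) hR₁ hR₁' hR₂ hW₁
  exact h

include B hA₀ hA₁ hA₂ hA₃ hA₁Dt hlo hhi in
/-- **Order 3, two radii (incremental, SHARP inputs)**: with free bounds `R₃ ≥ |u‴(θ)|`, common bounds `R₁′ ≥ |u′|, |u_K′|`,
`R₂′ ≥ |u″|, |u_K″|` and lower differences `W₁, W₂` at `θ`: the bound of `abs_deriv_three_root_sub_le` with `κ₂ = κ₃ = κ₄ = 0` (free side),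
`κ₁ = 2A₁`, `E₀ = A₀`, `E₁ = 2A₁`, `E₂ = 4A₂`, `E₃ = 8A₃` — LINEAR in `A₃`. [cite: BenfattoGiulianiMastropietro2006, §2.4 Lemma 2.1 (2.40)] -/
theorem abs_deriv_three_frameRadius_sub_bandFermiRadius_le {θ R₁' R₂' R₃ W₁ W₂ : ℝ} (hR₁ : |deriv (bandFermiRadius ν) θ| ≤ R₁')
    (hR₁' : |deriv (perturbedFermiRadius (fun p : Fin 2 → ℝ => -K.eval p) ν) θ| ≤ R₁')
    (hR₂ : |deriv (deriv (bandFermiRadius ν)) θ| ≤ R₂')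
    (hR₂' : |deriv (deriv (perturbedFermiRadius (fun p : Fin 2 → ℝ => -K.eval p) ν)) θ| ≤ R₂')
    (hR₃ : |deriv (deriv (deriv (bandFermiRadius ν))) θ| ≤ R₃)
    (hW₁ : |deriv (perturbedFermiRadius (fun p : Fin 2 → ℝ => -K.eval p) ν) θ - deriv (bandFermiRadius ν) θ| ≤ W₁)
    (hW₂ : |deriv (deriv (perturbedFermiRadius (fun p : Fin 2 → ℝ => -K.eval p) ν)) θ - deriv (deriv (bandFermiRadius ν)) θ| ≤ W₂) :
    |deriv (deriv (deriv (perturbedFermiRadius (fun p : Fin 2 → ℝ => -K.eval p) ν))) θ - deriv (deriv (deriv (bandFermiRadius ν))) θ| ≤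
      (((4 + 0) * (A₀ / (B.Dtmin - 2 * A₁)) + 8 * A₃) * (R₁' + π * Real.sqrt 2) ^ 3 +
        3 * (4 + 0) * (W₁ + A₀ / (B.Dtmin - 2 * A₁)) * (R₁' + π * Real.sqrt 2) ^ 2 +
        3 * (((4 + 0) * (A₀ / (B.Dtmin - 2 * A₁)) + 4 * A₂) * (R₁' + π * Real.sqrt 2) * (R₂' + 2 * R₁' + π * Real.sqrt 2) +
          (4 + 0) * ((W₂ + 2 * W₁ + A₀ / (B.Dtmin - 2 * A₁)) * (R₁' + π * Real.sqrt 2) +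
            (R₂' + 2 * R₁' + π * Real.sqrt 2) * (W₁ + A₀ / (B.Dtmin - 2 * A₁)))) +
        ((4 + 0) * (A₀ / (B.Dtmin - 2 * A₁)) + 2 * A₁) * (3 * R₂' + 3 * R₁' + π * Real.sqrt 2) +
        (4 + 2 * A₁) * (3 * W₂ + 3 * W₁ + A₀ / (B.Dtmin - 2 * A₁)) +
        R₃ * ((4 + 0) * (A₀ / (B.Dtmin - 2 * A₁)) + 2 * A₁)) / (B.Dtmin - 2 * A₁) := by
  have hA0 : 0 ≤ A₀ := le_trans (norm_nonneg _) (hA₀ 0)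
  have hA1 : 0 ≤ A₁ := le_trans (norm_nonneg _) (hA₁ 0)
  have h := abs_deriv_three_root_sub_le B (δ := (0 : (Fin 2 → ℝ) → ℝ)) (δ' := fun p : Fin 2 → ℝ => -K.eval p) contDiff_const
    contDiff_four_negEval (κ₀ := A₀) (κ₁ := 2 * A₁) (fun k _ => by simpa using hA0) (fun k _ => abs_negEval_le hA₀ k) hlo hhi
    (fun k _ => by simp; positivity) (fun k _ => norm_fderiv_negEval_le hA₁ k) hA₁Dt (u := bandFermiRadius ν)
    (v := perturbedFermiRadius (fun p : Fin 2 → ℝ => -K.eval p) ν)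
    (isBandFermiRadius_free B hA₀ hlo hhi) (isBandFermiRadius_frameRadius_perOrder B hA₀ hlo hhi)
    (E₀ := A₀) (fun k _ => by simpa using abs_negEval_le hA₀ k) (κ₂ := 0) (κ₃ := 0) (κ₄ := 0) (E₁ := 2 * A₁) (E₂ := 4 * A₂)
    (E₃ := 8 * A₃) (fun k _ => by simp) (fun k _ => by simp) (fun k _ => by simp)
    (fun k _ => by simpa using norm_fderiv_negEval_le hA₁ k) (fun k _ => by simpa using norm_fderiv_two_negEval_le hA₂ k)
    (fun k _ => by simpa using norm_fderiv_three_frameShift_le hA₃ k) hR₁ hR₁' hR₂ hR₂' hR₃ hW₁ hW₂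
  exact h

include B hA₀ hA₁ hA₂ hA₃ hA₄ hA₁Dt hlo hhi in
/-- **Order 4, two radii (incremental, SHARP inputs)**: the bound of `abs_deriv_four_root_sub_le` with `κ₂ = κ₃ = κ₄ = 0` (free side),
`κ₁ = 2A₁`, `E₀ = A₀`, `E₁ = 2A₁`, `E₂ = 4A₂`, `E₃ = 8A₃`, `E₄ = 16A₄` — LINEAR in `A₃, A₄`.
[cite: BenfattoGiulianiMastropietro2006, §2.4 Lemma 2.1 (2.40)] -/
theorem abs_deriv_four_frameRadius_sub_bandFermiRadius_le {θ R₁' R₂' R₃' R₄ W₁ W₂ W₃ : ℝ}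
    (hR₁ : |deriv (bandFermiRadius ν) θ| ≤ R₁') (hR₁' : |deriv (perturbedFermiRadius (fun p : Fin 2 → ℝ => -K.eval p) ν) θ| ≤ R₁')
    (hR₂ : |deriv (deriv (bandFermiRadius ν)) θ| ≤ R₂')
    (hR₂' : |deriv (deriv (perturbedFermiRadius (fun p : Fin 2 → ℝ => -K.eval p) ν)) θ| ≤ R₂')
    (hR₃ : |deriv (deriv (deriv (bandFermiRadius ν))) θ| ≤ R₃')
    (hR₃' : |deriv (deriv (deriv (perturbedFermiRadius (fun p : Fin 2 → ℝ => -K.eval p) ν))) θ| ≤ R₃')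
    (hR₄ : |deriv (deriv (deriv (deriv (bandFermiRadius ν)))) θ| ≤ R₄)
    (hW₁ : |deriv (perturbedFermiRadius (fun p : Fin 2 → ℝ => -K.eval p) ν) θ - deriv (bandFermiRadius ν) θ| ≤ W₁)
    (hW₂ : |deriv (deriv (perturbedFermiRadius (fun p : Fin 2 → ℝ => -K.eval p) ν)) θ - deriv (deriv (bandFermiRadius ν)) θ| ≤ W₂)
    (hW₃ : |deriv (deriv (deriv (perturbedFermiRadius (fun p : Fin 2 → ℝ => -K.eval p) ν))) θ -
      deriv (deriv (deriv (bandFermiRadius ν))) θ| ≤ W₃) :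
    |deriv (deriv (deriv (deriv (perturbedFermiRadius (fun p : Fin 2 → ℝ => -K.eval p) ν)))) θ -
        deriv (deriv (deriv (deriv (bandFermiRadius ν)))) θ| ≤
      ((4 * (A₀ / (B.Dtmin - 2 * A₁)) + 2 * 0 + 16 * A₄) * (R₁' + π * Real.sqrt 2) ^ 4 +
        4 * (4 + 0) * (W₁ + A₀ / (B.Dtmin - 2 * A₁)) * (R₁' + π * Real.sqrt 2) ^ 3 +
        6 * ((((4 + 0) * (A₀ / (B.Dtmin - 2 * A₁)) + 8 * A₃) * (R₁' + π * Real.sqrt 2) ^ 2 * (R₂' + 2 * R₁' + π * Real.sqrt 2) +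
          (4 + 0) * ((W₂ + 2 * W₁ + A₀ / (B.Dtmin - 2 * A₁)) * (R₁' + π * Real.sqrt 2) ^ 2 +
            2 * (R₁' + π * Real.sqrt 2) * (R₂' + 2 * R₁' + π * Real.sqrt 2) * (W₁ + A₀ / (B.Dtmin - 2 * A₁))))) +
        3 * ((((4 + 0) * (A₀ / (B.Dtmin - 2 * A₁)) + 4 * A₂) * (R₂' + 2 * R₁' + π * Real.sqrt 2) ^ 2 +
          2 * (4 + 0) * (R₂' + 2 * R₁' + π * Real.sqrt 2) * (W₂ + 2 * W₁ + A₀ / (B.Dtmin - 2 * A₁)))) +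
        4 * ((((4 + 0) * (A₀ / (B.Dtmin - 2 * A₁)) + 4 * A₂) * (R₁' + π * Real.sqrt 2) * (R₃' + 3 * R₁' + 3 * R₂' + π * Real.sqrt 2) +
          (4 + 0) * ((W₁ + A₀ / (B.Dtmin - 2 * A₁)) * (R₃' + 3 * R₁' + 3 * R₂' + π * Real.sqrt 2) +
            (R₁' + π * Real.sqrt 2) * (W₃ + 3 * W₁ + 3 * W₂ + A₀ / (B.Dtmin - 2 * A₁))))) +
        ((4 + 0) * (A₀ / (B.Dtmin - 2 * A₁)) + 2 * A₁) * (6 * R₂' + 4 * R₃' + 4 * R₁' + π * Real.sqrt 2) +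
        (4 + 2 * A₁) * (6 * W₂ + 4 * W₃ + 4 * W₁ + A₀ / (B.Dtmin - 2 * A₁)) +
        R₄ * ((4 + 0) * (A₀ / (B.Dtmin - 2 * A₁)) + 2 * A₁)) / (B.Dtmin - 2 * A₁) := by
  have hA0 : 0 ≤ A₀ := le_trans (norm_nonneg _) (hA₀ 0)
  have hA1 : 0 ≤ A₁ := le_trans (norm_nonneg _) (hA₁ 0)
  have h := abs_deriv_four_root_sub_le B (δ := (0 : (Fin 2 → ℝ) → ℝ)) (δ' := fun p : Fin 2 → ℝ => -K.eval p) contDiff_const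
    contDiff_four_negEval (κ₀ := A₀) (κ₁ := 2 * A₁) (fun k _ => by simpa using hA0) (fun k _ => abs_negEval_le hA₀ k) hlo hhi
    (fun k _ => by simp; positivity) (fun k _ => norm_fderiv_negEval_le hA₁ k) hA₁Dt (u := bandFermiRadius ν)
    (v := perturbedFermiRadius (fun p : Fin 2 → ℝ => -K.eval p) ν)
    (isBandFermiRadius_free B hA₀ hlo hhi) (isBandFermiRadius_frameRadius_perOrder B hA₀ hlo hhi)
    (E₀ := A₀) (fun k _ => by simpa using abs_negEval_le hA₀ k) (κ₂ := 0) (κ₃ := 0) (κ₄ := 0) (E₁ := 2 * A₁) (E₂ := 4 * A₂)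
    (E₃ := 8 * A₃) (E₄ := 16 * A₄) (fun k _ => by simp) (fun k _ => by simp) (fun k _ => by simp)
    (fun k _ => by simpa using norm_fderiv_negEval_le hA₁ k) (fun k _ => by simpa using norm_fderiv_two_negEval_le hA₂ k)
    (fun k _ => by simpa using norm_fderiv_three_frameShift_le hA₃ k) (fun k _ => by simpa using norm_fderiv_four_frameShift_le hA₄ k)
    hR₁ hR₁' hR₂ hR₂' hR₃ hR₃' hR₄ hW₁ hW₂ hW₃
  exact h

/-! ## §3 The packaged tower on a level window: SHARP free-band numbers in, the frame's numbers out -/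

omit B in
/-- `|x| ≤ R`, `|y − x| ≤ W` ⇒ `|y| ≤ R + W`. -/
theorem abs_le_add_of_abs_sub_le {x y R W : ℝ} (hx : |x| ≤ R) (h : |y - x| ≤ W) : |y| ≤ R + W := by
  have e : y = x + (y - x) := by ring
  rw [e]; exact (abs_add_le _ _).trans (add_le_add hx h)

include B hA₀ hA₁ hA₂ hA₃ hA₄ hA₁Dt hlo hhi in
/-- **THE FRAME'S POLAR TOWER ON A LEVEL WINDOW.**  Inputs: the FREE band's numbers on `[a, b]` — `u ≤ U₀`, `|u′| ≤ R₁`, `|u″| ≤ R₂`,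
`|u‴| ≤ R₃`, `|u⁗| ≤ R₄` for every level in `[a, b]` and every angle (the certified window table, KLCert pattern; or any proved bounds) —
the frame's per-order sizes `A₀ … A₄` (`2A₁ < Dt_min`, level `ν` with margins `A₀`), and numbers `W₁ … W₄` dominating the closed-form
widths of §2 (evaluated at `R₁′ = R₁ + W₁`, `R₂′ = R₂ + W₂`, `R₃′ = R₃ + W₃`; each width is affine in `(A₀, …, A_k)` up to products of the
`A`'s, so for an admissible flow frame at scale `n ≤ 3` they are `O(U)`-small).  Outputs at every angle `θ`: the five differences
`|u_K^{(k)}(θ) − u^{(k)}(θ)| ≤ W_k` (`W₀ = A₀/(Dt_min − 2A₁)`), the range `u_K(θ) ≤ U₀ + W₀`, and the frame's tower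
`|u_K′| ≤ R₁ + W₁`, `|u_K″| ≤ R₂ + W₂`, `|u_K‴| ≤ R₃ + W₃`, `|u_K⁗| ≤ R₄ + W₄` — the `U₀, R₁, R₂ (, R₃, R₄)` inputs of
`…C4aJacobianPolarJets` on the window (with `ρ₀ = Dt_min − 2A₁`, `Dtmin_sub_le_fderiv_frameBand_dir`).
[cite: BenfattoGiulianiMastropietro2006, §2.4 Lemma 2.1 (2.40)] -/
theorem frame_polar_tower_of_window {U₀ R₁ R₂ R₃ R₄ W₁ W₂ W₃ W₄ : ℝ}
    (hU₀ : ∀ μ ∈ Icc a b, ∀ θ : ℝ, bandFermiRadius μ θ ≤ U₀)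
    (hR₁ : ∀ μ ∈ Icc a b, ∀ θ : ℝ, |deriv (bandFermiRadius μ) θ| ≤ R₁)
    (hR₂ : ∀ μ ∈ Icc a b, ∀ θ : ℝ, |deriv (deriv (bandFermiRadius μ)) θ| ≤ R₂)
    (hR₃ : ∀ μ ∈ Icc a b, ∀ θ : ℝ, |deriv (deriv (deriv (bandFermiRadius μ))) θ| ≤ R₃)
    (hR₄ : ∀ μ ∈ Icc a b, ∀ θ : ℝ, |deriv (deriv (deriv (deriv (bandFermiRadius μ)))) θ| ≤ R₄)
    (hW₁ : ((4 + 2 * A₁) * (A₀ / (B.Dtmin - 2 * A₁)) +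
        (π * Real.sqrt 2 + (4 + 2 * A₁) * (π * Real.sqrt 2) / (B.Dtmin - 2 * A₁)) * ((4 + 0) * (A₀ / (B.Dtmin - 2 * A₁)) + 2 * A₁)) /
        (B.Dtmin - 2 * A₁) ≤ W₁)
    (hW₂ : A₀ / (B.Dtmin - 2 * A₁) +
        (((4 + 0) * (A₀ / (B.Dtmin - 2 * A₁)) + 4 * A₂) * ((R₁ + W₁) + π * Real.sqrt 2) ^ 2 +
          2 * (4 + 0) * ((R₁ + W₁) + π * Real.sqrt 2) * (W₁ + A₀ / (B.Dtmin - 2 * A₁)) +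
          ((4 + 0) * (A₀ / (B.Dtmin - 2 * A₁)) + 2 * A₁) * (2 * (R₁ + W₁) + π * Real.sqrt 2) +
          (4 + 2 * A₁) * (A₀ / (B.Dtmin - 2 * A₁) + 2 * W₁) +
          (R₂ + π * Real.sqrt 2) * ((4 + 0) * (A₀ / (B.Dtmin - 2 * A₁)) + 2 * A₁)) / (B.Dtmin - 2 * A₁) ≤ W₂)
    (hW₃ : (((4 + 0) * (A₀ / (B.Dtmin - 2 * A₁)) + 8 * A₃) * ((R₁ + W₁) + π * Real.sqrt 2) ^ 3 +
        3 * (4 + 0) * (W₁ + A₀ / (B.Dtmin - 2 * A₁)) * ((R₁ + W₁) + π * Real.sqrt 2) ^ 2 +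
        3 * (((4 + 0) * (A₀ / (B.Dtmin - 2 * A₁)) + 4 * A₂) * ((R₁ + W₁) + π * Real.sqrt 2) * ((R₂ + W₂) + 2 * (R₁ + W₁) + π * Real.sqrt 2) +
          (4 + 0) * ((W₂ + 2 * W₁ + A₀ / (B.Dtmin - 2 * A₁)) * ((R₁ + W₁) + π * Real.sqrt 2) +
            ((R₂ + W₂) + 2 * (R₁ + W₁) + π * Real.sqrt 2) * (W₁ + A₀ / (B.Dtmin - 2 * A₁)))) +
        ((4 + 0) * (A₀ / (B.Dtmin - 2 * A₁)) + 2 * A₁) * (3 * (R₂ + W₂) + 3 * (R₁ + W₁) + π * Real.sqrt 2) +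
        (4 + 2 * A₁) * (3 * W₂ + 3 * W₁ + A₀ / (B.Dtmin - 2 * A₁)) +
        R₃ * ((4 + 0) * (A₀ / (B.Dtmin - 2 * A₁)) + 2 * A₁)) / (B.Dtmin - 2 * A₁) ≤ W₃)
    (hW₄ : ((4 * (A₀ / (B.Dtmin - 2 * A₁)) + 2 * 0 + 16 * A₄) * ((R₁ + W₁) + π * Real.sqrt 2) ^ 4 +
        4 * (4 + 0) * (W₁ + A₀ / (B.Dtmin - 2 * A₁)) * ((R₁ + W₁) + π * Real.sqrt 2) ^ 3 +
        6 * ((((4 + 0) * (A₀ / (B.Dtmin - 2 * A₁)) + 8 * A₃) * ((R₁ + W₁) + π * Real.sqrt 2) ^ 2 * ((R₂ + W₂) + 2 * (R₁ + W₁) + π * Real.sqrt 2) +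
          (4 + 0) * ((W₂ + 2 * W₁ + A₀ / (B.Dtmin - 2 * A₁)) * ((R₁ + W₁) + π * Real.sqrt 2) ^ 2 +
            2 * ((R₁ + W₁) + π * Real.sqrt 2) * ((R₂ + W₂) + 2 * (R₁ + W₁) + π * Real.sqrt 2) * (W₁ + A₀ / (B.Dtmin - 2 * A₁))))) +
        3 * ((((4 + 0) * (A₀ / (B.Dtmin - 2 * A₁)) + 4 * A₂) * ((R₂ + W₂) + 2 * (R₁ + W₁) + π * Real.sqrt 2) ^ 2 +
          2 * (4 + 0) * ((R₂ + W₂) + 2 * (R₁ + W₁) + π * Real.sqrt 2) * (W₂ + 2 * W₁ + A₀ / (B.Dtmin - 2 * A₁)))) +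
        4 * ((((4 + 0) * (A₀ / (B.Dtmin - 2 * A₁)) + 4 * A₂) * ((R₁ + W₁) + π * Real.sqrt 2) * ((R₃ + W₃) + 3 * (R₁ + W₁) + 3 * (R₂ + W₂) + π * Real.sqrt 2) +
          (4 + 0) * ((W₁ + A₀ / (B.Dtmin - 2 * A₁)) * ((R₃ + W₃) + 3 * (R₁ + W₁) + 3 * (R₂ + W₂) + π * Real.sqrt 2) +
            ((R₁ + W₁) + π * Real.sqrt 2) * (W₃ + 3 * W₁ + 3 * W₂ + A₀ / (B.Dtmin - 2 * A₁))))) +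
        ((4 + 0) * (A₀ / (B.Dtmin - 2 * A₁)) + 2 * A₁) * (6 * (R₂ + W₂) + 4 * (R₃ + W₃) + 4 * (R₁ + W₁) + π * Real.sqrt 2) +
        (4 + 2 * A₁) * (6 * W₂ + 4 * W₃ + 4 * W₁ + A₀ / (B.Dtmin - 2 * A₁)) +
        R₄ * ((4 + 0) * (A₀ / (B.Dtmin - 2 * A₁)) + 2 * A₁)) / (B.Dtmin - 2 * A₁) ≤ W₄)
    (θ : ℝ) :
    |perturbedFermiRadius (fun p : Fin 2 → ℝ => -K.eval p) ν θ - bandFermiRadius ν θ| ≤ A₀ / (B.Dtmin - 2 * A₁) ∧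
    |deriv (perturbedFermiRadius (fun p : Fin 2 → ℝ => -K.eval p) ν) θ - deriv (bandFermiRadius ν) θ| ≤ W₁ ∧
    |deriv (deriv (perturbedFermiRadius (fun p : Fin 2 → ℝ => -K.eval p) ν)) θ - deriv (deriv (bandFermiRadius ν)) θ| ≤ W₂ ∧
    |deriv (deriv (deriv (perturbedFermiRadius (fun p : Fin 2 → ℝ => -K.eval p) ν))) θ -
        deriv (deriv (deriv (bandFermiRadius ν))) θ| ≤ W₃ ∧
    |deriv (deriv (deriv (deriv (perturbedFermiRadius (fun p : Fin 2 → ℝ => -K.eval p) ν)))) θ -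
        deriv (deriv (deriv (deriv (bandFermiRadius ν)))) θ| ≤ W₄ ∧
    perturbedFermiRadius (fun p : Fin 2 → ℝ => -K.eval p) ν θ ≤ U₀ + A₀ / (B.Dtmin - 2 * A₁) ∧
    |deriv (perturbedFermiRadius (fun p : Fin 2 → ℝ => -K.eval p) ν) θ| ≤ R₁ + W₁ ∧
    |deriv (deriv (perturbedFermiRadius (fun p : Fin 2 → ℝ => -K.eval p) ν)) θ| ≤ R₂ + W₂ ∧
    |deriv (deriv (deriv (perturbedFermiRadius (fun p : Fin 2 → ℝ => -K.eval p) ν))) θ| ≤ R₃ + W₃ ∧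
    |deriv (deriv (deriv (deriv (perturbedFermiRadius (fun p : Fin 2 → ℝ => -K.eval p) ν)))) θ| ≤ R₄ + W₄ := by
  have hA0 : 0 ≤ A₀ := le_trans (norm_nonneg _) (hA₀ 0)
  have hν : ν ∈ Icc a b := ⟨by linarith, by linarith⟩
  have d0 := abs_frameRadius_sub_bandFermiRadius_le B hA₀ hA₁ hA₁Dt hlo hhi θ
  have d1 := (abs_deriv_frameRadius_sub_bandFermiRadius_le B hA₀ hA₁ hA₁Dt hlo hhi θ).trans hW₁
  have f1 := hR₁ ν hν θ
  have W1nn : 0 ≤ W₁ := (abs_nonneg _).trans d1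
  have f1w : |deriv (bandFermiRadius ν) θ| ≤ R₁ + W₁ := f1.trans (le_add_of_nonneg_right W1nn)
  have r1 := abs_le_add_of_abs_sub_le f1 d1
  have f2 := hR₂ ν hν θ
  have d2 := (abs_deriv_two_frameRadius_sub_bandFermiRadius_le B hA₀ hA₁ hA₂ hA₁Dt hlo hhi f1w r1 f2 d1).trans hW₂
  have W2nn : 0 ≤ W₂ := (abs_nonneg _).trans d2
  have f2w : |deriv (deriv (bandFermiRadius ν)) θ| ≤ R₂ + W₂ := f2.trans (le_add_of_nonneg_right W2nn)
  have r2 := abs_le_add_of_abs_sub_le f2 d2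
  have f3 := hR₃ ν hν θ
  have d3 := (abs_deriv_three_frameRadius_sub_bandFermiRadius_le B hA₀ hA₁ hA₂ hA₃ hA₁Dt hlo hhi f1w r1 f2w r2 f3 d1 d2).trans hW₃
  have W3nn : 0 ≤ W₃ := (abs_nonneg _).trans d3
  have f3w : |deriv (deriv (deriv (bandFermiRadius ν))) θ| ≤ R₃ + W₃ := f3.trans (le_add_of_nonneg_right W3nn)
  have r3 := abs_le_add_of_abs_sub_le f3 d3
  have f4 := hR₄ ν hν θ
  have d4 := (abs_deriv_four_frameRadius_sub_bandFermiRadius_le B hA₀ hA₁ hA₂ hA₃ hA₄ hA₁Dt hlo hhi f1w r1 f2w r2 f3w r3 f4 d1 d2 d3).trans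
    hW₄
  have r4 := abs_le_add_of_abs_sub_le f4 d4
  exact ⟨d0, d1, d2, d3, d4, (frameRadius_le_of_window B hA₀ hA₁ hA₁Dt hlo hhi hU₀ θ).1, r1, r2, r3, r4⟩

end Frame

end Summit.HubbardSuperconductivity.HubbardSuperconductivity.Theorems.PerturbedFermiCurve

end
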